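import Summits.HodgeConjecture.HodgeConjecture.Theorems.LinearSystemTorelliTranscendentalOrSupportedStubBootstrap

/-!
# Crux `TranscendentalOrSupported` (stmt-HodgeConjecture-10853), line `Sketch` (skeleton v6,
# isotypic bootstrap in Gysin form) — stub `stub_bootstrapGeneral`: an irreducible rationally
# spanned sub-Hodge structure meeting a rationally spanned sub-Hodge structure `S` non-trivially
# lies in `S`

Helper file for the line skeleton of the crux `TranscendentalOrSupported` of route
`LinearSystemTorelli` (GHC(2p, coniveau 1) in Grothendieck's sub-Hodge form), registered stub
`stub_bootstrapGeneral`. Notation: `X` a scheme over `ℂ`, `A` a Hodge model of `X` in dimension `n`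
(`A.pullback k : Hᵏ(X(ℂ); ℂ) → Hᵏ(X^an; ℂ)` the comparison, `A.hodgePQ k p' q'` the piece `H^{p',q'}`
of the model), `k` a degree, and for a `ℂ`-subspace `V ⊆ Hᵏ(X(ℂ); ℂ)`:
* `V` is RATIONALLY SPANNED if `span ℂ {x ∈ V | x rational} = V` (`IsRationalClass`);
* `V` is SUB-HODGE (read in `A`) if `V.map A^* = ⨆_{p'+q'=k} V.map A^* ⊓ H^{p',q'}`.

CLAIM (`stub_bootstrapGeneral`; the landed `stub_bootstrap`, which is the case
`S = Nᶜ Hᵏ = supportedClasses X k c` granted Deligne, with the target subspace abstracted). Let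
`W ⊆ Hᵏ(X(ℂ); ℂ)` be rationally spanned, sub-Hodge and IRREDUCIBLE among such subspaces (its only
rationally spanned sub-Hodge subspaces are `⊥` and `W`), and let `S ⊆ Hᵏ(X(ℂ); ℂ)` be ANY rationally
spanned sub-Hodge subspace. If `W ⊓ S ≠ ⊥`, then `W ≤ S`.

PROOF. `U := W ⊓ S` is again a rationally spanned sub-Hodge subspace, `≤ W` and `≠ ⊥`, so `U = W`
by irreducibility, i.e. `W ≤ S`:
* **the intersection of two rationally spanned subspaces is rationally spanned**
  (`bootstrap_inf_le_span_isRationalClass`, landed with `stub_bootstrap`: through the injective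
  complexification `ℂ ⊗_ℚ Hᵏ(Y; ℚ) → Hᵏ(Y; ℂ)` and flatness of `ℂ/ℚ`);
* **the intersection of two sub-Hodge subspaces is sub-Hodge**: the Hodge components
  (`HodgeModel.exists_sum_eq_of_hodgeDecomposition`) of a class of `U` lie in `W` and in `S`
  (`perpSubHodge_component_mem`, landed with stub `stub_perpSubHodge`), hence in `U`, and
  `HodgeModel.isSubHodge_iff_le` concludes.

Pure tree theorems; no named fact is taken as a hypothesis and none is introduced.

## References

* [VoisinHodgeI2002] C. Voisin, Hodge Theory and Complex Algebraic Geometry I, CUP 2002, §7.1.1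
  (`Hᵏ(X, ℚ) ⊗ ℂ = Hᵏ(X, ℂ)`), §7.3.1 (sub-Hodge structures, Lemma 7.25 and the remark after
  Lemma 7.26).
* [GrothendieckTopology1969] A. Grothendieck, Hodge's general conjecture is false for trivial
  reasons, Topology 8 (1969), p. 300.
-/

noncomputable section

-- `Summit.HodgeConjecture.HodgeConjecture.Theorems` is the mandated namespace (single-problem summit:
-- Problem = Summit), flagged by `linter.dupNamespace`; restated for stand-alone elaboration.
set_option linter.dupNamespace false

open CategoryTheory
open Literature.AlgebraicGeometry.Motives Literature.AlgebraicGeometry.HodgeTheory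
open Literature.AlgebraicTopology.SingularHomology
-- `Finset.antidiagonal` alone resolves to the `Set.IsPWO` antidiagonal of `Data.Finset.MulAntidiagonal`
open Finset.HasAntidiagonal (antidiagonal mem_antidiagonal)

namespace Summit.HodgeConjecture.HodgeConjecture.Theorems

/-! ### The intersection of two sub-Hodge subspaces is sub-Hodge -/

/-- **The intersection of two sub-Hodge subspaces is a sub-Hodge subspace.** For a Hodge model `A`
of `X`, a degree `k` and `ℂ`-subspaces `W, S ⊆ Hᵏ(X(ℂ); ℂ)` whose pull-backs to `A` decompose into
Hodge pieces (`V.map A^* = ⨆_{p'+q'=k} V.map A^* ⊓ H^{p',q'}` for `V = W, S`), the pull-back of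
`W ⊓ S` decomposes too: the Hodge components (`HodgeModel.exists_sum_eq_of_hodgeDecomposition`) of a
class of `W ⊓ S` lie in `W` and in `S` (`perpSubHodge_component_mem`), hence in `W ⊓ S`, and
`HodgeModel.isSubHodge_iff_le` concludes.
[cite: VoisinHodgeI2002, §7.3.1 (Lemma 7.25 and the remark after Lemma 7.26)] -/
theorem bootstrapGeneral_inf_isSubHodge {n : ℕ} {X : SchemeOver ℂ} (A : HodgeModel n X) (k : ℕ)
    {W S : Submodule ℂ (complexBetti X k)}
    (hsubW : W.map (A.pullback k).hom =
      ⨆ (p' : ℕ) (q' : ℕ) (_ : p' + q' = k), W.map (A.pullback k).hom ⊓ A.hodgePQ k p' q')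
    (hsubS : S.map (A.pullback k).hom =
      ⨆ (p' : ℕ) (q' : ℕ) (_ : p' + q' = k), S.map (A.pullback k).hom ⊓ A.hodgePQ k p' q') :
    (W ⊓ S).map (A.pullback k).hom =
      ⨆ (p' : ℕ) (q' : ℕ) (_ : p' + q' = k), (W ⊓ S).map (A.pullback k).hom ⊓ A.hodgePQ k p' q' := by
  refine (A.isSubHodge_iff_le k _).2 ?_
  rintro _ ⟨u, ⟨huW, huS⟩, rfl⟩
  obtain ⟨z, hz, hzt⟩ := A.exists_sum_eq_of_hodgeDecomposition k u
  have hzW := perpSubHodge_component_mem A hsubW huW hz hzt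
  have hzS := perpSubHodge_component_mem A hsubS huS hz hzt
  have hsum : (A.pullback k).hom u = ∑ i ∈ antidiagonal k, (A.pullback k).hom (z i) := by
    rw [← map_sum, hz]
  rw [hsum]
  refine Submodule.sum_mem _ fun i hi ↦ ?_
  exact Submodule.mem_iSup_of_mem i.1 (Submodule.mem_iSup_of_mem i.2
    (Submodule.mem_iSup_of_mem (mem_antidiagonal.1 hi)
      ⟨Submodule.mem_map_of_mem ⟨hzW i hi, hzS i hi⟩, hzt i hi⟩))

/-! ### The stub -/

/-- **Isotypic bootstrap, general target** (stub `stub_bootstrapGeneral` of the line `Sketch`,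
skeleton v6, of the crux `TranscendentalOrSupported`; the landed `stub_bootstrap` with the supported
classes `Nᶜ Hᵏ` abstracted to any rationally spanned sub-Hodge subspace `S`): for a Hodge model `A`
of `X`, a degree `k`, an IRREDUCIBLE rationally spanned sub-Hodge subspace `W ⊆ Hᵏ(X(ℂ); ℂ)` (its
only rationally spanned sub-Hodge subspaces are `⊥` and `W`) and ANY rationally spanned sub-Hodge
subspace `S ⊆ Hᵏ(X(ℂ); ℂ)` meeting `W` non-trivially: `W ≤ S`. Proof: `U := W ⊓ S` is rationally
spanned (`bootstrap_inf_le_span_isRationalClass`) and sub-Hodge (`bootstrapGeneral_inf_isSubHodge`: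
the Hodge components of a class of `U` stay in `W` and in `S`, `perpSubHodge_component_mem`); it is
`≤ W` and `≠ ⊥`, hence `= W` by irreducibility, i.e. `W ≤ S`.
[cite: VoisinHodgeI2002, §7.3.1 (Lemma 7.25 and the remark after Lemma 7.26)] -/
theorem stub_bootstrapGeneral :
    ∀ ⦃n : ℕ⦄ ⦃X : SchemeOver ℂ⦄ (A : HodgeModel n X) (k : ℕ) (W S : Submodule ℂ (complexBetti X k)),
    Submodule.span ℂ {x : complexBetti X k | x ∈ W ∧ IsRationalClass x} = W →
    W.map (A.pullback k).hom =
      ⨆ (p' : ℕ) (q' : ℕ) (_ : p' + q' = k), W.map (A.pullback k).hom ⊓ A.hodgePQ k p' q' →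
    (∀ V : Submodule ℂ (complexBetti X k), V ≤ W →
      Submodule.span ℂ {x : complexBetti X k | x ∈ V ∧ IsRationalClass x} = V →
      V.map (A.pullback k).hom =
        ⨆ (p' : ℕ) (q' : ℕ) (_ : p' + q' = k), V.map (A.pullback k).hom ⊓ A.hodgePQ k p' q' →
      V = ⊥ ∨ V = W) →
    Submodule.span ℂ {x : complexBetti X k | x ∈ S ∧ IsRationalClass x} = S →
    S.map (A.pullback k).hom =
      ⨆ (p' : ℕ) (q' : ℕ) (_ : p' + q' = k), S.map (A.pullback k).hom ⊓ A.hodgePQ k p' q' →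
    W ⊓ S ≠ ⊥ → W ≤ S := by
  intro _ _ A k W S hratW hsubW hirr hratS hsubS hne
  -- `U := W ⊓ S` is spanned by its rational classes ...
  have hUrat : Submodule.span ℂ {x : complexBetti _ k | x ∈ W ⊓ S ∧ IsRationalClass x} = W ⊓ S :=
    le_antisymm (Submodule.span_le.2 fun x hx ↦ hx.1)
      (bootstrap_inf_le_span_isRationalClass k hratW.ge hratS.ge)
  -- ... and its pull-back to `A` is a sub-Hodge structure; irreducibility: `U = ⊥` is excluded,
  -- so `U = W`, i.e. `W ≤ S`
  rcases hirr _ inf_le_left hUrat (bootstrapGeneral_inf_isSubHodge A k hsubW hsubS) with h | h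
  · exact absurd h hne
  · exact inf_eq_left.1 h

end Summit.HodgeConjecture.HodgeConjecture.Theorems

end
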